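import Literature.NumberTheory.EllipticCurves.IwasawaAlgebraSpecializationLambdaTransferProofs
import HarnessLib

/-!
# Howard's specialisation device, assembled: uniform specialised index inequalities at the primes `T^m + p` and
# `f + p^m` imply `char(N') ^ k ⊆ char(N)` (module theory over `Λ = ℤ_p⟦T⟧`, proofs file)

Topic `NumberTheory/EllipticCurves`. THEOREMS ONLY (no definition, no named fact, no `sorry`). Assembles the `μ`-twin
(`IwasawaAlgebraSpecializationIndexProofs`, seat x10b: `#(N ⧸ q_m N) ≍ p^{m μ(N)}` at `q_m = T^m + p`) and the `λ`-twin
(`IwasawaAlgebraSpecializationLambda{,Transfer}Proofs`, this seat: `#(N ⧸ Q_m N) ≍ p^{m d ℓ_f(N)}` at `Q_m = f + p^m`) into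
the form in which a `Λ`-adic Kolyvagin-system argument USES them ([Howard 2004] proof of Thm. 2.2.10; [Mazur–Rubin 2004] §5.3,
proof of Thm. 5.3.10): local length inequalities at EVERY height-one prime — `(p)` and `(f)`, `f` distinguished irreducible,
which are all of them (`IwasawaAlgebra.eq_span_of_height_eq_one`) — give `char(N')^k ⊆ char(N)`, i.e. `char(N) ∣ char(N')^k`.
HONEST FRAMING: pure `Λ`-module algebra; the specialised bounds themselves (the arithmetic) are hypotheses; BSD is not proved
by any of this. Lead seat of line `birth`, crux K1 stmt-BirchSwinnertonDyer-24198 (research child A = stmt-26896).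

* `Module.charIdeal_pow_le_charIdeal_of_lengthAt_le` (any Noetherian domain; private helper `finset_prod_le_prod`) — `(∀ 𝔭 of height one, ℓ_𝔭(X) ≤ k·ℓ_𝔭(Y))
  ⟹ char(Y)^k ≤ char(X)` for finitely generated torsion `X, Y`.
* `IwasawaAlgebra.muInvariant_le_mul_of_card_quotSMulTop_qm_le`, `….lengthAt_le_mul_of_card_quotSMulTop_qm_le` — the
  `μ`-transfer for a general exponent `k` (x10b's lemma is `k = 2`).
* **`IwasawaAlgebra.charIdeal_pow_le_charIdeal_of_card_quotSMulTop_le`** — THE DEVICE: for f.g. torsion `N, N'`, uniform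
  inequalities `#(N ⧸ q N) ≤ p^C · #(N' ⧸ q N')^k` for all large `m` at `q = T^m + p` and at `q = f + p^m` for every distinguished
  irreducible `f` imply `char(N')^k ≤ char(N)`.

References: [Howard2004HeegnerKolyvagin] proof of Thm. 2.2.10; [MazurRubin2004] §5.3 (proof of Thm. 5.3.10); [Washington1997] §13.2;
[NeukirchSchmidtWingberg2008] Ch. V §3 ((5.3.7)–(5.3.8): the height-one primes of `Λ`).
-/

set_option autoImplicit false

noncomputable section

open scoped Classical Pointwise Polynomial

namespace Literature.NumberTheory.EllipticCurves

/-! ### §1 From local length inequalities to an inclusion of characteristic ideals -/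

namespace Module

variable {R : Type*} [CommRing R] [IsNoetherianRing R] [IsDomain R]

omit [IsNoetherianRing R] [IsDomain R] in
/-- A finite product of ideals is monotone in its factors (private helper). [folklore] -/
private theorem finset_prod_le_prod {ι : Type*} (s : Finset ι) {f g : ι → Ideal R} (h : ∀ i ∈ s, f i ≤ g i) :
    ∏ i ∈ s, f i ≤ ∏ i ∈ s, g i := by
  induction s using Finset.induction_on with
  | empty => simp
  | insert a s ha ih =>
    rw [Finset.prod_insert ha, Finset.prod_insert ha]
    exact Ideal.mul_mono (h a (Finset.mem_insert_self a s))
      (ih fun i hi => h i (Finset.mem_insert_of_mem hi))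

/-- **Local length inequalities ⟹ inclusion of characteristic ideals.** Over a Noetherian domain, for finitely generated
torsion modules `X, Y`: if `length_{R_𝔭} X_𝔭 ≤ k · length_{R_𝔭} Y_𝔭` at every prime `𝔭` of height one, then
`char(Y)^k ≤ char(X)` (`char = ∏_{ht 𝔭 = 1} 𝔭^{length}`, a finite product for torsion modules; compare factor by factor).
[cite: NeukirchSchmidtWingberg2008, Ch. V §3 (characteristic ideals via local lengths)] [cite: MazurRubin2004, §5.3 (proof of Thm. 5.3.10)] -/
theorem charIdeal_pow_le_charIdeal_of_lengthAt_le (X Y : Type*) [AddCommGroup X] [_root_.Module R X]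
    [AddCommGroup Y] [_root_.Module R Y] [Module.Finite R X] [Module.Finite R Y]
    (hX : Module.IsTorsion R X) (hY : Module.IsTorsion R Y) (k : ℕ)
    (h : ∀ 𝔭 : PrimeSpectrum R, 𝔭.asIdeal.height = 1 → lengthAt R X 𝔭 ≤ k * lengthAt R Y 𝔭) :
    charIdeal R Y ^ k ≤ charIdeal R X := by
  classical
  obtain ⟨s, hsann, hs0⟩ := Submodule.annihilator_top_inter_nonZeroDivisors hX
  obtain ⟨t, htann, ht0⟩ := Submodule.annihilator_top_inter_nonZeroDivisors hY
  have hsX : Module.IsTorsionBy R X s := fun x => Submodule.mem_annihilator.mp hsann x Submodule.mem_top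
  have htY : Module.IsTorsionBy R Y t := fun y => Submodule.mem_annihilator.mp htann y Submodule.mem_top
  set S : Set (PrimeSpectrum R) := {𝔭 | 𝔭.asIdeal.height = 1} with hS
  set FX : PrimeSpectrum R → Ideal R := fun 𝔭 => 𝔭.asIdeal ^ (lengthAt R X 𝔭).toNat with hFX
  set FY : PrimeSpectrum R → Ideal R := fun 𝔭 => 𝔭.asIdeal ^ (lengthAt R Y 𝔭).toNat with hFY
  have hfinX : (Function.mulSupport (S.mulIndicator FX)).Finite := by
    rw [Set.mulSupport_mulIndicator]
    exact finite_heightOne_inter_mulSupport (nonZeroDivisors.ne_zero hs0) hsX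
  have hfinY : (Function.mulSupport (S.mulIndicator FY)).Finite := by
    rw [Set.mulSupport_mulIndicator]
    exact finite_heightOne_inter_mulSupport (nonZeroDivisors.ne_zero ht0) htY
  -- both characteristic ideals as products over one finite set of primes
  set T : Finset (PrimeSpectrum R) := (hfinX.union hfinY).toFinset with hT
  have hTX : Function.mulSupport (S.mulIndicator FX) ⊆ (T : Set (PrimeSpectrum R)) := by
    rw [hT, Set.Finite.coe_toFinset]; exact Set.subset_union_left
  have hTY : Function.mulSupport (S.mulIndicator FY) ⊆ (T : Set (PrimeSpectrum R)) := by
    rw [hT, Set.Finite.coe_toFinset]; exact Set.subset_union_right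
  have hcX : charIdeal R X = ∏ 𝔭 ∈ T, S.mulIndicator FX 𝔭 := by
    unfold charIdeal
    rw [finprod_mem_def, finprod_eq_prod_of_mulSupport_subset _ hTX]
  have hcY : charIdeal R Y = ∏ 𝔭 ∈ T, S.mulIndicator FY 𝔭 := by
    unfold charIdeal
    rw [finprod_mem_def, finprod_eq_prod_of_mulSupport_subset _ hTY]
  rw [hcX, hcY, ← Finset.prod_pow]
  refine finset_prod_le_prod T fun 𝔭 _ => ?_
  by_cases h𝔭 : 𝔭 ∈ S
  · rw [Set.mulIndicator_of_mem h𝔭, Set.mulIndicator_of_mem h𝔭, hFX, hFY]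
    dsimp only
    rw [← pow_mul]
    refine Ideal.pow_le_pow_right ?_
    -- `ℓ(X) ≤ k ℓ(Y)` at the finite level
    have hXt : lengthAt R X 𝔭 ≠ ⊤ := lengthAt_ne_top_of_isTorsionBy (nonZeroDivisors.ne_zero hs0) hsX 𝔭 (le_of_eq h𝔭)
    have hYt : lengthAt R Y 𝔭 ≠ ⊤ := lengthAt_ne_top_of_isTorsionBy (nonZeroDivisors.ne_zero ht0) htY 𝔭 (le_of_eq h𝔭)
    have h1 := h 𝔭 h𝔭
    rw [← ENat.coe_toNat hXt, ← ENat.coe_toNat hYt] at h1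
    rw [mul_comm]
    exact_mod_cast h1
  · rw [Set.mulIndicator_of_notMem h𝔭, Set.mulIndicator_of_notMem h𝔭, one_pow]

end Module

/-! ### §2 The `μ`-transfer for a general exponent `k` -/

namespace IwasawaAlgebra

variable (p : ℕ) [Fact p.Prime]

/-- **μ-transfer, general exponent**: for f.g. torsion `Λ`-modules `N, N'`, if
`#(N ⧸ q_m N) ≤ p^C · #(N' ⧸ q_m N')^k` for all `m ≥ m₀` (`q_m = T^m + p`), then `μ(N) ≤ k μ(N')` (x10b's
`muInvariant_le_two_mul_of_card_quotSMulTop_qm_le` is the case `k = 2`; same proof).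
[cite: Howard2004HeegnerKolyvagin, proof of Thm. 2.2.10 (specialisation at T^m + p)] [cite: Washington1997, §13.2] -/
theorem muInvariant_le_mul_of_card_quotSMulTop_qm_le (N N' : Type*) [AddCommGroup N]
    [Module (IwasawaAlgebra p) N] [AddCommGroup N'] [Module (IwasawaAlgebra p) N']
    [Module.Finite (IwasawaAlgebra p) N] [Module.Finite (IwasawaAlgebra p) N']
    (hN : Module.IsTorsion (IwasawaAlgebra p) N) (hN' : Module.IsTorsion (IwasawaAlgebra p) N') {k : ℕ}
    (h : ∃ C m₀ : ℕ, ∀ m : ℕ, m₀ ≤ m →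
      Nat.card (N ⧸ (Ideal.span {(PowerSeries.X ^ m + PowerSeries.C (p : ℤ_[p]) : IwasawaAlgebra p)} • ⊤ :
        Submodule (IwasawaAlgebra p) N)) ≤
      p ^ C * Nat.card (N' ⧸ (Ideal.span {(PowerSeries.X ^ m + PowerSeries.C (p : ℤ_[p]) :
        IwasawaAlgebra p)} • ⊤ : Submodule (IwasawaAlgebra p) N')) ^ k) :
    muInvariant p N ≤ k * muInvariant p N' := by
  have hp : p.Prime := Fact.out
  obtain ⟨C, m₀, hC⟩ := h
  obtain ⟨B, m₁, -, h1⟩ := exists_card_quotSMulTop_qm_bounds p N hN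
  obtain ⟨B', m₂, -, h2⟩ := exists_card_quotSMulTop_qm_bounds p N' hN'
  refine le_of_forall_pow_mul_le hp.one_lt (D := B * p ^ C * B' ^ k) (m₀ := max m₀ (max m₁ m₂))
    fun m hm => ?_
  have hm0 : m₀ ≤ m := le_trans (le_max_left _ _) hm
  have hm1 : m₁ ≤ m := le_trans (le_trans (le_max_left _ _) (le_max_right _ _)) hm
  have hm2 : m₂ ≤ m := le_trans (le_trans (le_max_right _ _) (le_max_right _ _)) hm
  obtain ⟨-, hlow, -⟩ := h1 m hm1
  obtain ⟨-, -, hup⟩ := h2 m hm2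
  calc p ^ (m * muInvariant p N) ≤ B * Nat.card (N ⧸ _) := hlow
    _ ≤ B * (p ^ C * Nat.card (N' ⧸ _) ^ k) := Nat.mul_le_mul_left _ (hC m hm0)
    _ ≤ B * (p ^ C * (B' * p ^ (m * muInvariant p N')) ^ k) := by gcongr
    _ = B * p ^ C * B' ^ k * p ^ (m * (k * muInvariant p N')) := by
        rw [mul_pow, ← pow_mul]; ring_nf

/-- The same in local-length currency at `𝔭 = (p)`: `length N_(p) ≤ k · length N'_(p)`.
[cite: Howard2004HeegnerKolyvagin, proof of Thm. 2.2.10] [cite: Washington1997, §13.2] -/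
theorem lengthAt_le_mul_of_card_quotSMulTop_qm_le (N N' : Type*) [AddCommGroup N]
    [Module (IwasawaAlgebra p) N] [AddCommGroup N'] [Module (IwasawaAlgebra p) N']
    [Module.Finite (IwasawaAlgebra p) N] [Module.Finite (IwasawaAlgebra p) N']
    (hN : Module.IsTorsion (IwasawaAlgebra p) N) (hN' : Module.IsTorsion (IwasawaAlgebra p) N') {k : ℕ}
    (h : ∃ C m₀ : ℕ, ∀ m : ℕ, m₀ ≤ m →
      Nat.card (N ⧸ (Ideal.span {(PowerSeries.X ^ m + PowerSeries.C (p : ℤ_[p]) : IwasawaAlgebra p)} • ⊤ :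
        Submodule (IwasawaAlgebra p) N)) ≤
      p ^ C * Nat.card (N' ⧸ (Ideal.span {(PowerSeries.X ^ m + PowerSeries.C (p : ℤ_[p]) :
        IwasawaAlgebra p)} • ⊤ : Submodule (IwasawaAlgebra p) N')) ^ k)
    (𝔭 : PrimeSpectrum (IwasawaAlgebra p)) (h𝔭 : 𝔭.asIdeal = Ideal.span {PowerSeries.C (p : ℤ_[p])}) :
    Module.lengthAt (IwasawaAlgebra p) N 𝔭 ≤ k * Module.lengthAt (IwasawaAlgebra p) N' 𝔭 := by
  have h1 := muInvariant_le_mul_of_card_quotSMulTop_qm_le p N N' hN hN' h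
  have h𝔭' : 𝔭.asIdeal = augIdealP p := h𝔭
  have hN1 := lengthAt_ne_top_of_isTorsion p N hN 𝔭 h𝔭'
  have hN2 := lengthAt_ne_top_of_isTorsion p N' hN' 𝔭 h𝔭'
  rw [muInvariant_eq_toNat_lengthAt p N 𝔭 h𝔭', muInvariant_eq_toNat_lengthAt p N' 𝔭 h𝔭'] at h1
  rw [← ENat.coe_toNat hN1, ← ENat.coe_toNat hN2]
  exact_mod_cast h1

/-! ### §3 The device -/

/-- **HOWARD'S SPECIALISATION DEVICE (module-theoretic half, assembled).** Let `N, N'` be finitely generated torsion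
`Λ`-modules and `k ∈ ℕ`. Suppose uniform specialised index inequalities hold at Howard's test primes:
(μ) `#(N ⧸ q_m N) ≤ p^C · #(N' ⧸ q_m N')^k` for all large `m`, `q_m = T^m + p`; and (λ) for every distinguished irreducible
`f ∈ ℤ_p[T]`, `#(N ⧸ Q_m N) ≤ p^C · #(N' ⧸ Q_m N')^k` for all large `m`, `Q_m = f + p^m` (constants may depend on `f`).
Then `char(N')^k ≤ char(N)`, i.e. `char(N) ∣ char(N')^k`. (Every height-one prime of `Λ` is `(p)` or `(f)`; at `(p)` the
μ-transfer, at `(f)` the λ-transfer give `ℓ_𝔭(N) ≤ k ℓ_𝔭(N')`; then compare `∏ 𝔭^{ℓ_𝔭}` factor by factor.) In Howard's and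
Mazur–Rubin's arguments `N = X` (a dual Selmer group), `N' = 𝔖/Λκ` (or its square, `k = 2`), and (μ), (λ) are the specialised
Kolyvagin-system bounds. [cite: Howard2004HeegnerKolyvagin, proof of Thm. 2.2.10] [cite: MazurRubin2004, §5.3 (proof of Thm. 5.3.10)] -/
theorem charIdeal_pow_le_charIdeal_of_card_quotSMulTop_le (N N' : Type*) [AddCommGroup N]
    [Module (IwasawaAlgebra p) N] [AddCommGroup N'] [Module (IwasawaAlgebra p) N']
    [Module.Finite (IwasawaAlgebra p) N] [Module.Finite (IwasawaAlgebra p) N']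
    (hN : Module.IsTorsion (IwasawaAlgebra p) N) (hN' : Module.IsTorsion (IwasawaAlgebra p) N') (k : ℕ)
    (hmu : ∃ C m₀ : ℕ, ∀ m : ℕ, m₀ ≤ m →
      Nat.card (N ⧸ (Ideal.span {(PowerSeries.X ^ m + PowerSeries.C (p : ℤ_[p]) : IwasawaAlgebra p)} • ⊤ :
        Submodule (IwasawaAlgebra p) N)) ≤
      p ^ C * Nat.card (N' ⧸ (Ideal.span {(PowerSeries.X ^ m + PowerSeries.C (p : ℤ_[p]) :
        IwasawaAlgebra p)} • ⊤ : Submodule (IwasawaAlgebra p) N')) ^ k)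
    (hlam : ∀ f : ℤ_[p][X], f.IsDistinguishedAt (IsLocalRing.maximalIdeal ℤ_[p]) → Irreducible f →
      ∃ C m₀ : ℕ, ∀ m : ℕ, m₀ ≤ m →
        Nat.card (N ⧸ (Ideal.span {(f : IwasawaAlgebra p) + PowerSeries.C ((p : ℤ_[p]) ^ m)} • ⊤ :
          Submodule (IwasawaAlgebra p) N)) ≤
        p ^ C * Nat.card (N' ⧸ (Ideal.span {(f : IwasawaAlgebra p) + PowerSeries.C ((p : ℤ_[p]) ^ m)} • ⊤ :
          Submodule (IwasawaAlgebra p) N')) ^ k) :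
    Module.charIdeal (IwasawaAlgebra p) N' ^ k ≤ Module.charIdeal (IwasawaAlgebra p) N := by
  refine Module.charIdeal_pow_le_charIdeal_of_lengthAt_le N N' hN hN' k fun 𝔭 h𝔭 => ?_
  haveI := 𝔭.isPrime
  rcases eq_span_of_height_eq_one p 𝔭.asIdeal h𝔭 with h𝔭p | ⟨f, hf, hirr, h𝔭f⟩
  · exact lengthAt_le_mul_of_card_quotSMulTop_qm_le p N N' hN hN' hmu 𝔭 h𝔭p
  · exact lengthAt_le_mul_of_card_quotSMulTop_add_C_pow_le p N N' hN hN' hf hirr (hlam f hf hirr) 𝔭 h𝔭f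

end IwasawaAlgebra

end Literature.NumberTheory.EllipticCurves

end
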